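import Summits.QuantumFields.YangMills.Theorems.UnitScaleTiltProp7CornerCombGaugeRowKernel
import HarnessLib

/-!
# Route `UnitScaleTilt`, crux K1 «MinimiserStabilityRegPr» (stmt-QuantumFields-19200), route-R E′ (A′)-on-Σ, P-A2 (β), row «(n3)-comb» —
# (O2) GROUNDWORK: THE FOUR GAUGE-ROW WEIGHTS OF F-8b-5b-1, CHOSEN BY EQUALITY, AND THE `wM` SQUARE WINDOW (pure reals)

«(O2) groundwork — not consumed by any displayed row before the freeze lifts» (★★OWNER `ym3-torus-plan` g29∕g30 RULINGS №20 (2), №22 (c) «(II) GO»).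
Cell `ym3-torus` (HUMAN RULING D-0037: YM₃ on T³ is ladder rung R3 — not d = 4, not infinite volume, not a mass gap, not Clay), D-0154 (3c) R3 twin-width
seat `ym-routeR-w4` (gen 18), typed AT OWN RISK for the `hMc` knit F-8c-final-2 (★routeR-w1 g10) and its (G_j) twin F-9c (routeR-w3 g9); lands only on the
pen-namer's word.  THEOREMS ONLY (0 `def`, 0 `sorry`); imports ✓`Prop7CornerCombGaugeRowKernel` (for `cL_nonneg`) and Mathlib through it;
`--supports stmt-QuantumFields-19200 --as helper`, count-neutral.  Nothing here claims `hMcomb`, (β), `hPA2`, the stub, the crux, d = 4 or the mass gap.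

THE POINT.  ★routeR-w6 g9's F-8b-5b-1 `Prop7CornerCombGaugeRowInhabited.gauge_row_inhabited` (SIGNATURE-0 2026-08-29 12:30Z, sha16 2ff0a75e834de491) delivers the
cell theorem's displayed gauge row `hrow` under FOUR LETTER DOMINATIONS `hdomG`∕`hdomN`∕`hdomM`∕`hdomS` whose left-hand sides are ✓`gauge_row_kernel_le`'s three
closed coefficients `Γc`, `Μc i`, `Δc` (read at `n := nC`, `A := AC`, `wq := α`, `δ i := 4·α i`) — the knit DISCHARGES them by CHOOSING the weights BY EQUALITY
(`wG := 2Γc`, `wN := 8dΓc`, `wS := 2Δc`, `wM i := 2Μc i + 4Δc·(210(2d+2)L)²(α i)²(2d)`, ★routeR-w6 g9 12:30:47Z).  The closed cell theorem (F-8b-4 v2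
✓p719061 ∘ 5b-1 = 5b-2) then still wants, of these choices: `0 ≤ wG`, `0 ≤ wN`, `0 ≤ wS` (§1), `∀ j, 0 ≤ wM j` (§2) and the GEOMETRIC WINDOW
`hwMgeo : ∀ j < k, wM j ≤ ΘM·ρ^{4(k−j)}` with `ΘM` chosen BEFORE the member (§3).  §3 is the one non-trivial line: every term of `Μc i` carries `(a i)²`,
`(8((d+1)L)²·a i + 8·α i)²` or `(2dL·(4α i) + 2((3d+1)nC)²·a i)²`, and the `Δc`-term carries `(α i)²`; with the block-loop window proportional to the plaquette
window, `0 ≤ α i ≤ cα·a i` (✓F-8c-3a `norm_Wcx_avgIter_pull_sub_one_le_level_of_regPr`: `cα = 2·8(d+1)(d+4)L²`), the whole left-hand side of `hdomM` is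
`≤ ΘM♯·(a i)²` with `ΘM♯ :=` THE SAME TEXT READ AT `a i := 1`, `α i := cα` (★ `wM_choice_le_sq`, monotonicity in `α` + degree-2 homogeneity), hence
`≤ (ΘM♯·aC²)·ρ^{4(k−j)}` once `a j ≤ aC·ρ^{4(k−j)}` (★ `wM_choice_geo`; one window power spent, one kept — the pattern of ✓`Prop7CombLevelMassSlotLetters.wM_geo_of_sq_window`).
§4: the two numerals `nC := L·L + L − 1`, `AC := 2` of 5b-1's `hnC`∕`hnA`, and `√L = ρ⁻¹` at `ρ := (√L)⁻¹`.
HONEST SCOPE.  Pure real∕natural-number bookkeeping on literal texts; no lattice object; nothing of F-8b-5b∕F-8c-final is proved here.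

References: T. Bałaban, CMP **109** (1987) 249–301 [Balaban1987RG1] ((0.1), (0.4) pp.251–253: the level weights of the inductive `ℓ²` bounds); CMP **98** (1985) 17–51
[Balaban1985Averaging] ((42)–(47) pp.23–25: block loops `∝` plaquettes; (52)–(54) p.26: the geometric plaquette windows).
-/

set_option autoImplicit false

noncomputable section

open scoped BigOperators
open Finset

namespace Summit.QuantumFields.YangMills.Theorems.Prop7CornerCombGaugeRowWeights

open Summit.QuantumFields.YangMills.Theorems.Prop7CornerCombGaugeRowKernel (cL_nonneg)

variable (L d N nC AC : ℕ)

/-- `1 < L` as reals from `2 ≤ L`. [folklore] -/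
private theorem one_lt_cast {L : ℕ} (hL : 2 ≤ L) : (1 : ℝ) < (L : ℝ) := by exact_mod_cast (show 1 < L by omega)

/-! ## §1 The three constant weights are nonnegative -/

/-- `0 ≤ wG` for the choice `wG := 2Γc` (the left-hand side of 5b-1's `hdomG`). [bookkeeping] -/
theorem wG_choice_nonneg (hL : 2 ≤ L) :
    0 ≤ 2 * (3 * ((Real.sqrt L)⁻¹ * ((d : ℝ) * ((L : ℝ) ^ 2 / 4) * (2 * ((L : ℝ) ^ d)⁻¹ * (L : ℝ) * (L : ℝ)))
              + (L : ℝ)⁻¹ * (2 * (d : ℝ) * (1 - (Real.sqrt L)⁻¹)⁻¹ * ((L : ℝ) ^ 2 / 4) * 2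
                  * (((L : ℝ) ^ d)⁻¹ * (3 * N * ((nC : ℝ) + 1) ^ 2 * ((d : ℝ) * ((d : ℝ) * (AC : ℝ) ^ d)))))
              + (Real.sqrt L)⁻¹ * (2 * (1 - (Real.sqrt L)⁻¹)⁻¹ * 2 * (N / 2 * (d : ℝ) ^ 2 * ((L : ℝ) - 1) ^ 2 * (L : ℝ) ^ 2 * (d : ℝ))))) := by
  have hcL0 := cL_nonneg (one_lt_cast hL)
  have h1 : 0 ≤ ((L : ℝ) - 1) ^ 2 := sq_nonneg _
  positivity

/-- `0 ≤ wN` for the choice `wN := 8dΓc` (the left-hand side of 5b-1's `hdomN`). [bookkeeping] -/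
theorem wN_choice_nonneg (hL : 2 ≤ L) :
    0 ≤ 8 * (d : ℝ) * (3 * ((Real.sqrt L)⁻¹ * ((d : ℝ) * ((L : ℝ) ^ 2 / 4) * (2 * ((L : ℝ) ^ d)⁻¹ * (L : ℝ) * (L : ℝ)))
              + (L : ℝ)⁻¹ * (2 * (d : ℝ) * (1 - (Real.sqrt L)⁻¹)⁻¹ * ((L : ℝ) ^ 2 / 4) * 2
                  * (((L : ℝ) ^ d)⁻¹ * (3 * N * ((nC : ℝ) + 1) ^ 2 * ((d : ℝ) * ((d : ℝ) * (AC : ℝ) ^ d)))))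
              + (Real.sqrt L)⁻¹ * (2 * (1 - (Real.sqrt L)⁻¹)⁻¹ * 2 * (N / 2 * (d : ℝ) ^ 2 * ((L : ℝ) - 1) ^ 2 * (L : ℝ) ^ 2 * (d : ℝ))))) := by
  have hcL0 := cL_nonneg (one_lt_cast hL)
  have h1 : 0 ≤ ((L : ℝ) - 1) ^ 2 := sq_nonneg _
  positivity

/-- `0 ≤ wS` for the choice `wS := 2Δc` (the left-hand side of 5b-1's `hdomS`). [bookkeeping] -/
theorem wS_choice_nonneg (hL : 2 ≤ L) :
    0 ≤ 2 * (3 * ((L : ℝ)⁻¹ * (2 * (d : ℝ) * (1 - (Real.sqrt L)⁻¹)⁻¹ * ((L : ℝ) ^ 2 / 4) * 2 * (3 * ((L : ℝ) ^ 2)⁻¹ * ((L : ℝ) ^ d)⁻¹ * (d : ℝ))))) := by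
  have hcL0 := cL_nonneg (one_lt_cast hL)
  positivity

/-! ## §2 The level weight `wM i` is nonnegative -/

/-- `0 ≤ wM i` for the choice `wM i := 2Μc i + 4Δc·(210(2d+2)L)²(α i)²(2d)` (the left-hand side of 5b-1's `hdomM`), for ANY real windows `a α`.
[bookkeeping] -/
theorem wM_choice_nonneg (hL : 2 ≤ L) (a α : ℕ → ℝ) (i : ℕ) :
    0 ≤ 2 * (3 * ((Real.sqrt L)⁻¹ * ((d : ℝ) * ((L : ℝ) ^ 2 / 4)
                * (2 * ((L : ℝ) ^ d)⁻¹ * (8 * (((d : ℝ) + 1) * (L : ℝ)) ^ 2 * a i + 8 * α i) ^ 2 * (d : ℝ)))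
              + (L : ℝ)⁻¹ * (2 * (d : ℝ) * (1 - (Real.sqrt L)⁻¹)⁻¹ * ((L : ℝ) ^ 2 / 4) * 2
                  * (((L : ℝ) ^ d)⁻¹ * ((12 * N * ((nC : ℝ) + 1) ^ 2 * (d : ℝ) ^ 3 * (nC : ℝ) ^ 2 * a i ^ 2
                      + 3 * (2 * d * L * (4 * α i) + 2 * ((3 * d + 1) * nC : ℝ) ^ 2 * a i) ^ 2) * ((d : ℝ) * ((d : ℝ) * (AC : ℝ) ^ d)))))
              + (Real.sqrt L)⁻¹ * (2 * (1 - (Real.sqrt L)⁻¹)⁻¹ * 2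
                  * ((8 * (d : ℝ) ^ 6 * ((L : ℝ) - 1) ^ 6 + 2 * N * (d : ℝ) ^ 5 * ((L : ℝ) - 1) ^ 4 * (L : ℝ) ^ 2) * a i ^ 2 * (d : ℝ)))))
          + 4 * (3 * ((L : ℝ)⁻¹ * (2 * (d : ℝ) * (1 - (Real.sqrt L)⁻¹)⁻¹ * ((L : ℝ) ^ 2 / 4) * 2 * (3 * ((L : ℝ) ^ 2)⁻¹ * ((L : ℝ) ^ d)⁻¹ * (d : ℝ)))))
              * ((210 * ((2 * d + 2) * L)) ^ 2 * α i ^ 2 * (2 * d)) := by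
  have hcL0 := cL_nonneg (one_lt_cast hL)
  have h1 : 0 ≤ ((L : ℝ) - 1) ^ 6 := by positivity
  have h2 : 0 ≤ ((L : ℝ) - 1) ^ 4 := by positivity
  positivity

/-! ## §3 ★ The `wM` square window -/

/-- ★ **THE `wM` SQUARE WINDOW.**  If the block-loop window is proportional to the plaquette window, `0 ≤ α i ≤ cα·a i` (`0 ≤ a i`; no sign needed on `cα`), then the
choice `wM i := 2Μc i + 4Δc·(210(2d+2)L)²(α i)²(2d)` is at most `ΘM♯·(a i)²`, where `ΘM♯` is THE SAME TEXT read at `a i := 1`, `α i := cα`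
(monotone in `α i ≥ 0`, then homogeneous of degree two in `(a i, α i)`). [bookkeeping; cite: Balaban1985Averaging, (42)–(47) pp.23–25] -/
theorem wM_choice_le_sq (hL : 2 ≤ L) {cα : ℝ} (a α : ℕ → ℝ) (i : ℕ) (ha : 0 ≤ a i) (hα0 : 0 ≤ α i)
    (hαa : α i ≤ cα * a i) :
    2 * (3 * ((Real.sqrt L)⁻¹ * ((d : ℝ) * ((L : ℝ) ^ 2 / 4)
                * (2 * ((L : ℝ) ^ d)⁻¹ * (8 * (((d : ℝ) + 1) * (L : ℝ)) ^ 2 * a i + 8 * α i) ^ 2 * (d : ℝ)))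
              + (L : ℝ)⁻¹ * (2 * (d : ℝ) * (1 - (Real.sqrt L)⁻¹)⁻¹ * ((L : ℝ) ^ 2 / 4) * 2
                  * (((L : ℝ) ^ d)⁻¹ * ((12 * N * ((nC : ℝ) + 1) ^ 2 * (d : ℝ) ^ 3 * (nC : ℝ) ^ 2 * a i ^ 2
                      + 3 * (2 * d * L * (4 * α i) + 2 * ((3 * d + 1) * nC : ℝ) ^ 2 * a i) ^ 2) * ((d : ℝ) * ((d : ℝ) * (AC : ℝ) ^ d)))))
              + (Real.sqrt L)⁻¹ * (2 * (1 - (Real.sqrt L)⁻¹)⁻¹ * 2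
                  * ((8 * (d : ℝ) ^ 6 * ((L : ℝ) - 1) ^ 6 + 2 * N * (d : ℝ) ^ 5 * ((L : ℝ) - 1) ^ 4 * (L : ℝ) ^ 2) * a i ^ 2 * (d : ℝ)))))
          + 4 * (3 * ((L : ℝ)⁻¹ * (2 * (d : ℝ) * (1 - (Real.sqrt L)⁻¹)⁻¹ * ((L : ℝ) ^ 2 / 4) * 2 * (3 * ((L : ℝ) ^ 2)⁻¹ * ((L : ℝ) ^ d)⁻¹ * (d : ℝ)))))
              * ((210 * ((2 * d + 2) * L)) ^ 2 * α i ^ 2 * (2 * d))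
      ≤ (2 * (3 * ((Real.sqrt L)⁻¹ * ((d : ℝ) * ((L : ℝ) ^ 2 / 4)
                * (2 * ((L : ℝ) ^ d)⁻¹ * (8 * (((d : ℝ) + 1) * (L : ℝ)) ^ 2 * 1 + 8 * cα) ^ 2 * (d : ℝ)))
              + (L : ℝ)⁻¹ * (2 * (d : ℝ) * (1 - (Real.sqrt L)⁻¹)⁻¹ * ((L : ℝ) ^ 2 / 4) * 2
                  * (((L : ℝ) ^ d)⁻¹ * ((12 * N * ((nC : ℝ) + 1) ^ 2 * (d : ℝ) ^ 3 * (nC : ℝ) ^ 2 * 1 ^ 2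
                      + 3 * (2 * d * L * (4 * cα) + 2 * ((3 * d + 1) * nC : ℝ) ^ 2 * 1) ^ 2) * ((d : ℝ) * ((d : ℝ) * (AC : ℝ) ^ d)))))
              + (Real.sqrt L)⁻¹ * (2 * (1 - (Real.sqrt L)⁻¹)⁻¹ * 2
                  * ((8 * (d : ℝ) ^ 6 * ((L : ℝ) - 1) ^ 6 + 2 * N * (d : ℝ) ^ 5 * ((L : ℝ) - 1) ^ 4 * (L : ℝ) ^ 2) * 1 ^ 2 * (d : ℝ)))))
          + 4 * (3 * ((L : ℝ)⁻¹ * (2 * (d : ℝ) * (1 - (Real.sqrt L)⁻¹)⁻¹ * ((L : ℝ) ^ 2 / 4) * 2 * (3 * ((L : ℝ) ^ 2)⁻¹ * ((L : ℝ) ^ d)⁻¹ * (d : ℝ)))))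
              * ((210 * ((2 * d + 2) * L)) ^ 2 * cα ^ 2 * (2 * d))) * a i ^ 2 := by
  have hL1 : (1 : ℝ) < (L : ℝ) := one_lt_cast hL
  have hcL0 := cL_nonneg hL1
  have hE0 : 0 ≤ (8 * (d : ℝ) ^ 6 * ((L : ℝ) - 1) ^ 6 + 2 * N * (d : ℝ) ^ 5 * ((L : ℝ) - 1) ^ 4 * (L : ℝ) ^ 2) := by
    have h1 : 0 ≤ ((L : ℝ) - 1) ^ 6 := by positivity
    have h2 : 0 ≤ ((L : ℝ) - 1) ^ 4 := by positivity
    positivity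
  -- monotone in `α i`
  have hmono : 2 * (3 * ((Real.sqrt L)⁻¹ * ((d : ℝ) * ((L : ℝ) ^ 2 / 4)
                * (2 * ((L : ℝ) ^ d)⁻¹ * (8 * (((d : ℝ) + 1) * (L : ℝ)) ^ 2 * a i + 8 * α i) ^ 2 * (d : ℝ)))
              + (L : ℝ)⁻¹ * (2 * (d : ℝ) * (1 - (Real.sqrt L)⁻¹)⁻¹ * ((L : ℝ) ^ 2 / 4) * 2
                  * (((L : ℝ) ^ d)⁻¹ * ((12 * N * ((nC : ℝ) + 1) ^ 2 * (d : ℝ) ^ 3 * (nC : ℝ) ^ 2 * a i ^ 2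
                      + 3 * (2 * d * L * (4 * α i) + 2 * ((3 * d + 1) * nC : ℝ) ^ 2 * a i) ^ 2) * ((d : ℝ) * ((d : ℝ) * (AC : ℝ) ^ d)))))
              + (Real.sqrt L)⁻¹ * (2 * (1 - (Real.sqrt L)⁻¹)⁻¹ * 2
                  * ((8 * (d : ℝ) ^ 6 * ((L : ℝ) - 1) ^ 6 + 2 * N * (d : ℝ) ^ 5 * ((L : ℝ) - 1) ^ 4 * (L : ℝ) ^ 2) * a i ^ 2 * (d : ℝ)))))
          + 4 * (3 * ((L : ℝ)⁻¹ * (2 * (d : ℝ) * (1 - (Real.sqrt L)⁻¹)⁻¹ * ((L : ℝ) ^ 2 / 4) * 2 * (3 * ((L : ℝ) ^ 2)⁻¹ * ((L : ℝ) ^ d)⁻¹ * (d : ℝ)))))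
              * ((210 * ((2 * d + 2) * L)) ^ 2 * α i ^ 2 * (2 * d))
      ≤ 2 * (3 * ((Real.sqrt L)⁻¹ * ((d : ℝ) * ((L : ℝ) ^ 2 / 4)
                * (2 * ((L : ℝ) ^ d)⁻¹ * (8 * (((d : ℝ) + 1) * (L : ℝ)) ^ 2 * a i + 8 * (cα * a i)) ^ 2 * (d : ℝ)))
              + (L : ℝ)⁻¹ * (2 * (d : ℝ) * (1 - (Real.sqrt L)⁻¹)⁻¹ * ((L : ℝ) ^ 2 / 4) * 2
                  * (((L : ℝ) ^ d)⁻¹ * ((12 * N * ((nC : ℝ) + 1) ^ 2 * (d : ℝ) ^ 3 * (nC : ℝ) ^ 2 * a i ^ 2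
                      + 3 * (2 * d * L * (4 * (cα * a i)) + 2 * ((3 * d + 1) * nC : ℝ) ^ 2 * a i) ^ 2) * ((d : ℝ) * ((d : ℝ) * (AC : ℝ) ^ d)))))
              + (Real.sqrt L)⁻¹ * (2 * (1 - (Real.sqrt L)⁻¹)⁻¹ * 2
                  * ((8 * (d : ℝ) ^ 6 * ((L : ℝ) - 1) ^ 6 + 2 * N * (d : ℝ) ^ 5 * ((L : ℝ) - 1) ^ 4 * (L : ℝ) ^ 2) * a i ^ 2 * (d : ℝ)))))
          + 4 * (3 * ((L : ℝ)⁻¹ * (2 * (d : ℝ) * (1 - (Real.sqrt L)⁻¹)⁻¹ * ((L : ℝ) ^ 2 / 4) * 2 * (3 * ((L : ℝ) ^ 2)⁻¹ * ((L : ℝ) ^ d)⁻¹ * (d : ℝ)))))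
              * ((210 * ((2 * d + 2) * L)) ^ 2 * (cα * a i) ^ 2 * (2 * d)) := by
    gcongr
  -- degree-two homogeneity (opaque coefficient letters keep `ring` small)
  generalize (Real.sqrt (L : ℝ))⁻¹ = sI at hmono ⊢
  generalize (1 - sI)⁻¹ = cL at hmono ⊢
  generalize (8 * (d : ℝ) ^ 6 * ((L : ℝ) - 1) ^ 6 + 2 * N * (d : ℝ) ^ 5 * ((L : ℝ) - 1) ^ 4 * (L : ℝ) ^ 2) = E at hmono ⊢
  generalize ((L : ℝ) ^ d)⁻¹ = Ld at hmono ⊢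
  generalize ((d : ℝ) * ((d : ℝ) * (AC : ℝ) ^ d)) = Ad at hmono ⊢
  refine hmono.trans (le_of_eq ?_)
  ring

/-- `0 ≤ ΘM♯` (the text of §3's constant). [bookkeeping] -/
theorem ThetaM_choice_nonneg (hL : 2 ≤ L) (cα : ℝ) :
    0 ≤ 2 * (3 * ((Real.sqrt L)⁻¹ * ((d : ℝ) * ((L : ℝ) ^ 2 / 4)
                * (2 * ((L : ℝ) ^ d)⁻¹ * (8 * (((d : ℝ) + 1) * (L : ℝ)) ^ 2 * 1 + 8 * cα) ^ 2 * (d : ℝ)))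
              + (L : ℝ)⁻¹ * (2 * (d : ℝ) * (1 - (Real.sqrt L)⁻¹)⁻¹ * ((L : ℝ) ^ 2 / 4) * 2
                  * (((L : ℝ) ^ d)⁻¹ * ((12 * N * ((nC : ℝ) + 1) ^ 2 * (d : ℝ) ^ 3 * (nC : ℝ) ^ 2 * 1 ^ 2
                      + 3 * (2 * d * L * (4 * cα) + 2 * ((3 * d + 1) * nC : ℝ) ^ 2 * 1) ^ 2) * ((d : ℝ) * ((d : ℝ) * (AC : ℝ) ^ d)))))
              + (Real.sqrt L)⁻¹ * (2 * (1 - (Real.sqrt L)⁻¹)⁻¹ * 2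
                  * ((8 * (d : ℝ) ^ 6 * ((L : ℝ) - 1) ^ 6 + 2 * N * (d : ℝ) ^ 5 * ((L : ℝ) - 1) ^ 4 * (L : ℝ) ^ 2) * 1 ^ 2 * (d : ℝ)))))
          + 4 * (3 * ((L : ℝ)⁻¹ * (2 * (d : ℝ) * (1 - (Real.sqrt L)⁻¹)⁻¹ * ((L : ℝ) ^ 2 / 4) * 2 * (3 * ((L : ℝ) ^ 2)⁻¹ * ((L : ℝ) ^ d)⁻¹ * (d : ℝ)))))
              * ((210 * ((2 * d + 2) * L)) ^ 2 * cα ^ 2 * (2 * d)) :=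
  wM_choice_nonneg L d N nC AC hL (fun _ => 1) (fun _ => cα) 0

/-- ★ **`hwMgeo` FOR THE CHOSEN `wM`**: with `0 ≤ α j ≤ cα·a j`, `0 ≤ a j ≤ aC·ρ^{4(k−j)}` (`j < k`) and `0 ≤ ρ ≤ 1`, the choice `wM j` is at most
`(ΘM♯·aC²)·ρ^{4(k−j)}` — F-8b-4 v2's `hwMgeo` with `ΘM := ΘM♯·aC²`, a constant of `L d N nC AC cα aC` only (chosen before the member).
[bookkeeping; cite: Balaban1987RG1, (0.4) p.253; Balaban1985Averaging, (52)–(54) p.26] -/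
theorem wM_choice_geo (hL : 2 ≤ L) {cα ρ aC : ℝ} (hρ0 : 0 ≤ ρ) (hρ1 : ρ ≤ 1) (a α : ℕ → ℝ)
    (ha0 : ∀ j, 0 ≤ a j) (hα0 : ∀ j, 0 ≤ α j) (hαa : ∀ j, α j ≤ cα * a j) {k : ℕ} (haC : ∀ j < k, a j ≤ aC * ρ ^ (4 * (k - j))) :
    ∀ j < k, 2 * (3 * ((Real.sqrt L)⁻¹ * ((d : ℝ) * ((L : ℝ) ^ 2 / 4)
                * (2 * ((L : ℝ) ^ d)⁻¹ * (8 * (((d : ℝ) + 1) * (L : ℝ)) ^ 2 * a j + 8 * α j) ^ 2 * (d : ℝ)))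
              + (L : ℝ)⁻¹ * (2 * (d : ℝ) * (1 - (Real.sqrt L)⁻¹)⁻¹ * ((L : ℝ) ^ 2 / 4) * 2
                  * (((L : ℝ) ^ d)⁻¹ * ((12 * N * ((nC : ℝ) + 1) ^ 2 * (d : ℝ) ^ 3 * (nC : ℝ) ^ 2 * a j ^ 2
                      + 3 * (2 * d * L * (4 * α j) + 2 * ((3 * d + 1) * nC : ℝ) ^ 2 * a j) ^ 2) * ((d : ℝ) * ((d : ℝ) * (AC : ℝ) ^ d)))))
              + (Real.sqrt L)⁻¹ * (2 * (1 - (Real.sqrt L)⁻¹)⁻¹ * 2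
                  * ((8 * (d : ℝ) ^ 6 * ((L : ℝ) - 1) ^ 6 + 2 * N * (d : ℝ) ^ 5 * ((L : ℝ) - 1) ^ 4 * (L : ℝ) ^ 2) * a j ^ 2 * (d : ℝ)))))
          + 4 * (3 * ((L : ℝ)⁻¹ * (2 * (d : ℝ) * (1 - (Real.sqrt L)⁻¹)⁻¹ * ((L : ℝ) ^ 2 / 4) * 2 * (3 * ((L : ℝ) ^ 2)⁻¹ * ((L : ℝ) ^ d)⁻¹ * (d : ℝ)))))
              * ((210 * ((2 * d + 2) * L)) ^ 2 * α j ^ 2 * (2 * d))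
      ≤ ((2 * (3 * ((Real.sqrt L)⁻¹ * ((d : ℝ) * ((L : ℝ) ^ 2 / 4)
                * (2 * ((L : ℝ) ^ d)⁻¹ * (8 * (((d : ℝ) + 1) * (L : ℝ)) ^ 2 * 1 + 8 * cα) ^ 2 * (d : ℝ)))
              + (L : ℝ)⁻¹ * (2 * (d : ℝ) * (1 - (Real.sqrt L)⁻¹)⁻¹ * ((L : ℝ) ^ 2 / 4) * 2
                  * (((L : ℝ) ^ d)⁻¹ * ((12 * N * ((nC : ℝ) + 1) ^ 2 * (d : ℝ) ^ 3 * (nC : ℝ) ^ 2 * 1 ^ 2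
                      + 3 * (2 * d * L * (4 * cα) + 2 * ((3 * d + 1) * nC : ℝ) ^ 2 * 1) ^ 2) * ((d : ℝ) * ((d : ℝ) * (AC : ℝ) ^ d)))))
              + (Real.sqrt L)⁻¹ * (2 * (1 - (Real.sqrt L)⁻¹)⁻¹ * 2
                  * ((8 * (d : ℝ) ^ 6 * ((L : ℝ) - 1) ^ 6 + 2 * N * (d : ℝ) ^ 5 * ((L : ℝ) - 1) ^ 4 * (L : ℝ) ^ 2) * 1 ^ 2 * (d : ℝ)))))
          + 4 * (3 * ((L : ℝ)⁻¹ * (2 * (d : ℝ) * (1 - (Real.sqrt L)⁻¹)⁻¹ * ((L : ℝ) ^ 2 / 4) * 2 * (3 * ((L : ℝ) ^ 2)⁻¹ * ((L : ℝ) ^ d)⁻¹ * (d : ℝ)))))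
              * ((210 * ((2 * d + 2) * L)) ^ 2 * cα ^ 2 * (2 * d))) * aC ^ 2) * ρ ^ (4 * (k - j)) := by
  intro j hj
  have hΘ := ThetaM_choice_nonneg L d N nC AC hL cα
  have hsq := wM_choice_le_sq L d N nC AC hL a α j (ha0 j) (hα0 j) (hαa j)
  generalize 2 * (3 * ((Real.sqrt L)⁻¹ * ((d : ℝ) * ((L : ℝ) ^ 2 / 4)
                * (2 * ((L : ℝ) ^ d)⁻¹ * (8 * (((d : ℝ) + 1) * (L : ℝ)) ^ 2 * 1 + 8 * cα) ^ 2 * (d : ℝ)))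
              + (L : ℝ)⁻¹ * (2 * (d : ℝ) * (1 - (Real.sqrt L)⁻¹)⁻¹ * ((L : ℝ) ^ 2 / 4) * 2
                  * (((L : ℝ) ^ d)⁻¹ * ((12 * N * ((nC : ℝ) + 1) ^ 2 * (d : ℝ) ^ 3 * (nC : ℝ) ^ 2 * 1 ^ 2
                      + 3 * (2 * d * L * (4 * cα) + 2 * ((3 * d + 1) * nC : ℝ) ^ 2 * 1) ^ 2) * ((d : ℝ) * ((d : ℝ) * (AC : ℝ) ^ d)))))
              + (Real.sqrt L)⁻¹ * (2 * (1 - (Real.sqrt L)⁻¹)⁻¹ * 2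
                  * ((8 * (d : ℝ) ^ 6 * ((L : ℝ) - 1) ^ 6 + 2 * N * (d : ℝ) ^ 5 * ((L : ℝ) - 1) ^ 4 * (L : ℝ) ^ 2) * 1 ^ 2 * (d : ℝ)))))
          + 4 * (3 * ((L : ℝ)⁻¹ * (2 * (d : ℝ) * (1 - (Real.sqrt L)⁻¹)⁻¹ * ((L : ℝ) ^ 2 / 4) * 2 * (3 * ((L : ℝ) ^ 2)⁻¹ * ((L : ℝ) ^ d)⁻¹ * (d : ℝ)))))
              * ((210 * ((2 * d + 2) * L)) ^ 2 * cα ^ 2 * (2 * d)) = Θ at hΘ hsq ⊢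
  have hX0 : 0 ≤ ρ ^ (4 * (k - j)) := by positivity
  have hX1 : ρ ^ (4 * (k - j)) ≤ 1 := pow_le_one₀ hρ0 hρ1
  have h1 : a j ^ 2 ≤ (aC * ρ ^ (4 * (k - j))) ^ 2 := pow_le_pow_left₀ (ha0 j) (haC j hj) 2
  have h2 : (aC * ρ ^ (4 * (k - j))) ^ 2 ≤ aC ^ 2 * ρ ^ (4 * (k - j)) := by
    have : aC ^ 2 * (ρ ^ (4 * (k - j)) * ρ ^ (4 * (k - j))) ≤ aC ^ 2 * (ρ ^ (4 * (k - j)) * 1) :=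
      mul_le_mul_of_nonneg_left (mul_le_mul_of_nonneg_left hX1 hX0) (sq_nonneg _)
    nlinarith [this]
  calc _ ≤ Θ * a j ^ 2 := hsq
    _ ≤ Θ * (aC ^ 2 * ρ ^ (4 * (k - j))) := mul_le_mul_of_nonneg_left (h1.trans h2) hΘ
    _ = _ := by ring

/-! ## §4 The two numerals of 5b-1 and the kernel letter -/

/-- The numerals `nC := L·L + L − 1`, `AC := 2` inhabit 5b-1's `hnC : L·L + L ≤ nC + 1` and `hnA : nC + 1 ≤ AC·(L·L)` (`1 ≤ L`). [bookkeeping] -/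
theorem numerals_nC_AC {L : ℕ} (hL : 1 ≤ L) : L * L + L ≤ (L * L + L - 1) + 1 ∧ (L * L + L - 1) + 1 ≤ 2 * (L * L) := by
  have h1 : 1 ≤ L * L + L := le_add_left hL
  have h2 : L ≤ L * L := Nat.le_mul_self L
  omega

/-- The kernel letter of 5b-1's `hρs` at `ρ := (√L)⁻¹`: `√L = ρ⁻¹`. [folklore] -/
theorem sqrt_eq_inv_inv_sqrt (L : ℝ) : Real.sqrt L = ((Real.sqrt L)⁻¹)⁻¹ := (inv_inv _).symm

/-- At `ρ := (√L)⁻¹`, `1 < L`: `0 < ρ`, `ρ < 1`, `ρ ≤ 1` (the letters `hρ0`∕`hρ1` of the cell theorem and §3's `hρ1`). [folklore] -/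
theorem inv_sqrt_window {L : ℝ} (hL : 1 < L) : 0 < (Real.sqrt L)⁻¹ ∧ (Real.sqrt L)⁻¹ < 1 ∧ (Real.sqrt L)⁻¹ ≤ 1 := by
  have hs : 1 < Real.sqrt L := by
    have := Real.sqrt_lt_sqrt (by norm_num) hL
    rwa [Real.sqrt_one] at this
  have h0 : 0 < (Real.sqrt L)⁻¹ := inv_pos.mpr (by linarith)
  have h1 : (Real.sqrt L)⁻¹ < 1 := inv_lt_one_of_one_lt₀ hs
  exact ⟨h0, h1, h1.le⟩

end Summit.QuantumFields.YangMills.Theorems.Prop7CornerCombGaugeRowWeights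

end
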